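/-
Origin: expansion seat `planner-pub-hodgecm-landherr-g6-0`, handover 2026-08-18T06:07:20Z (`HOME/pub-hodgecm-landherr-g6/lean/LandherrG6/LandherrHermitian.lean`, md5 310d1d94, 416 lines);
landed by the gen-6 packager in gate run 24 as `HodgeCM/Proofs/LandherrHermitian.lean` (verbatim).
-/
/-
Copyright: pub-hodgecm formalisation cell (harness21, 2026).  New file (not vendored, not a port).
Origin: HOME/pub-hodgecm-landherr-g6/lean/LandherrG6/LandherrHermitian.lean — unit pub-hodgecm-landherr-g6
(EXPANSION part (c) `Lemma33bLandherr`, generation 6), session planner-pub-hodgecm-landherr-g6-0, 2026-08-18.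
Proposed final place: `HodgeCM/Proofs/LandherrHermitian.lean` (imports only landed modules).
-/
import Summits.HodgeConjecture.HodgeCM.Literature.NormTheoremHolds
import Summits.HodgeConjecture.HodgeCM.Proofs.LandherrNecessity
import Mathlib.LinearAlgebra.Matrix.PosDef

/-!
# Landherr's classification of hermitian PLANES over a CM field, for arbitrary Gram matrices

`HodgeCM.Lemma33bLandherr` (StubTree/Inputs.lean:54, PROVED: `HodgeCM.lemma33bLandherr_holds`, run 22) and
its converse `HodgeCM.lemma33bLandherr_converse` (run 15) classify DIAGONAL hermitian planes `⟨a₀, a₁⟩`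
over the CM field `L` (w.r.t. `L/L₀`, `σ =` complex conjugation) — exactly the shape PerL v5 ll. 299–304
consumes (`W₁ ⊕ W₂ ≅ W₃ ⊕ W₄`, orthogonal sums of lines).  This file removes the word "diagonal": for two
non-degenerate `σ`-hermitian `2 × 2` matrices `H, H'` over `L`,

  `∃ g ∈ GL₂(L), ᵗ(σg) · H · g = H'`  ↔  (same signature at every complex embedding `τ`) ∧ `det H ≡ det H'`
                                         in `L₀^× / N_{L/L₀}(L^×)`,

which is Landherr's theorem [La36] for `n = 2` as printed (Shimura, Doc. Math. 13 (2008) Thm. 2.2 p. 748;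
Rogawski, Ann. of Math. Stud. 123 (1990) §1.9 pp. 9–10: hermitian spaces over `L/L₀` are classified by
dimension, discriminant in `L₀^×/N(L^×)` and the signatures at the real places of `L₀`).  For a PLANE the
signature at `τ` is one of `(2,0), (1,1), (0,2)`, i.e. "`τ(H)` positive definite / indefinite / negative
definite", so "same signature at `τ`" is typed as
`((H.map τ).PosDef ↔ (H'.map τ).PosDef) ∧ ((-H.map τ).PosDef ↔ (-H'.map τ).PosDef)` (Mathlib's
`Matrix.PosDef` over `ℂ` with the `ComplexOrder` star ordering); each real place of `L₀` is a pair of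
complex-conjugate embeddings `τ, τ̄` of `L` giving complex-conjugate, hence equi-signed, Gram matrices.

Proof: Gram–Schmidt over `L/L₀` (`exists_diagonalize`: every non-degenerate hermitian plane has an
orthogonal basis, three elementary cases on which Gram entry is non-zero), invariance of the typed
signature and of the discriminant class under `H ↦ ᵗ(σg) H g` (`posDef_congr_iff`, `det_congr`), the
dictionary "`τ(diag(d))` positive definite ↔ `0 < τ(dᵢ)` for all `i`" (`posDef_diagonal_iff'`), and then
`lemma33bLandherr_holds` on the diagonalised planes (`landherr_planes`); the converse
(`landherr_planes_converse`) is direct from the two invariance lemmas.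
Inputs: only theorems of the package and Mathlib; no named fact, no hypothesis; closure of every
declaration = `[propext, Classical.choice, Quot.sound]`.
-/

noncomputable section

open NumberField
open scoped Matrix ComplexOrder

namespace HodgeCM

open Literature.AlgebraicGeometry.ShimuraVarieties (conjRingHomK embedding_conjRingHomK)

namespace LandherrHermitian

variable (L : CMField)

/-! ### The `σ`-conjugate transpose `ᵗ(σA)` -/

/-- `ᵗ(σA)`, the conjugate transpose of a `2 × 2` matrix over `L` for the involution `σ` of `L/L₀`
(the package writes it `Aᵀ.map (conjRingHomK L)` everywhere, and so do the three final theorems below;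
`cT` is proof-internal shorthand, definitionally equal to it). -/
def cT (A : Matrix (Fin 2) (Fin 2) L) : Matrix (Fin 2) (Fin 2) L := A.transpose.map (conjRingHomK L)

/-- (Ported verbatim from the HodgeCMPerL package; no docstring in the source.) -/
@[simp] theorem cT_apply (A : Matrix (Fin 2) (Fin 2) L) (i j : Fin 2) :
    cT L A i j = conjRingHomK L (A j i) := rfl

/-- (Ported verbatim from the HodgeCMPerL package; no docstring in the source.) -/
theorem cT_mul (A B : Matrix (Fin 2) (Fin 2) L) : cT L (A * B) = cT L B * cT L A := by
  rw [cT, cT, cT, Matrix.transpose_mul, Matrix.map_mul]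

/-- (Ported verbatim from the HodgeCMPerL package; no docstring in the source.) -/
@[simp] theorem cT_one : cT L 1 = (1 : Matrix (Fin 2) (Fin 2) L) := by
  ext i j
  fin_cases i <;> fin_cases j <;> simp

/-- (Ported verbatim from the HodgeCMPerL package; no docstring in the source.) -/
@[simp] theorem cT_cT (A : Matrix (Fin 2) (Fin 2) L) : cT L (cT L A) = A := by
  ext i j; simp

/-- (Ported verbatim from the HodgeCMPerL package; no docstring in the source.) -/
theorem cT_neg (A : Matrix (Fin 2) (Fin 2) L) : cT L (-A) = -cT L A := by
  ext i j; simp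

/-- (Ported verbatim from the HodgeCMPerL package; no docstring in the source.) -/
theorem det_cT (A : Matrix (Fin 2) (Fin 2) L) : (cT L A).det = conjRingHomK L A.det := by
  rw [cT, ← RingHom.mapMatrix_apply, ← RingHom.map_det, Matrix.det_transpose]

/-- `det (ᵗ(σg) H g) = det H · N(det g)`. -/
theorem det_congr (g H : Matrix (Fin 2) (Fin 2) L) :
    (cT L g * H * g).det = H.det * (g.det * conjRingHomK L g.det) := by
  rw [Matrix.det_mul, Matrix.det_mul, det_cT]; ring

/-- `ᵗ(σ g⁻¹) (ᵗ(σg) H g) g⁻¹ = H` for `g ∈ GL₂(L)`. -/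
theorem congr_inv_congr (g : GL (Fin 2) L) (H : Matrix (Fin 2) (Fin 2) L) :
    cT L ((g⁻¹ : GL (Fin 2) L) : Matrix (Fin 2) (Fin 2) L) *
        (cT L (g : Matrix (Fin 2) (Fin 2) L) * H * (g : Matrix (Fin 2) (Fin 2) L)) *
      ((g⁻¹ : GL (Fin 2) L) : Matrix (Fin 2) (Fin 2) L) = H := by
  have h1 : (g : Matrix (Fin 2) (Fin 2) L) * ((g⁻¹ : GL (Fin 2) L) : Matrix (Fin 2) (Fin 2) L) = 1 := by
    rw [← Matrix.GeneralLinearGroup.coe_mul, mul_inv_cancel]; rfl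
  calc _ = cT L ((g : Matrix (Fin 2) (Fin 2) L) * ((g⁻¹ : GL (Fin 2) L) : Matrix (Fin 2) (Fin 2) L)) * H *
        ((g : Matrix (Fin 2) (Fin 2) L) * ((g⁻¹ : GL (Fin 2) L) : Matrix (Fin 2) (Fin 2) L)) := by
          rw [cT_mul]; simp only [Matrix.mul_assoc]
    _ = H := by rw [h1, cT_one, Matrix.one_mul, Matrix.mul_one]

/-! ### Complex embeddings: `τ(ᵗ(σg) H g) = (τg)ᴴ (τH) (τg)` and invariance of the typed signature -/

/-- (Ported verbatim from the HodgeCMPerL package; no docstring in the source.) -/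
theorem map_cT (τ : L →+* ℂ) (A : Matrix (Fin 2) (Fin 2) L) : (cT L A).map τ = (A.map τ)ᴴ := by
  ext i j
  simp [Matrix.conjTranspose_apply, embedding_conjRingHomK]

/-- (Ported verbatim from the HodgeCMPerL package; no docstring in the source.) -/
theorem map_congr (τ : L →+* ℂ) (g H : Matrix (Fin 2) (Fin 2) L) :
    (cT L g * H * g).map τ = (g.map τ)ᴴ * H.map τ * g.map τ := by
  rw [Matrix.map_mul, Matrix.map_mul, map_cT]

/-- (Ported verbatim from the HodgeCMPerL package; no docstring in the source.) -/
theorem isUnit_map (τ : L →+* ℂ) (g : GL (Fin 2) L) : IsUnit ((g : Matrix (Fin 2) (Fin 2) L).map τ) := by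
  rw [Matrix.isUnit_iff_isUnit_det, ← RingHom.mapMatrix_apply, ← RingHom.map_det]
  exact (Matrix.isUnits_det_units g).map τ

/-- (Ported verbatim from the HodgeCMPerL package; no docstring in the source.) -/
theorem posDef_congr (τ : L →+* ℂ) (g : GL (Fin 2) L) {H : Matrix (Fin 2) (Fin 2) L}
    (h : (H.map τ).PosDef) :
    ((cT L (g : Matrix (Fin 2) (Fin 2) L) * H * (g : Matrix (Fin 2) (Fin 2) L)).map τ).PosDef := by
  rw [map_congr]
  exact h.conjTranspose_mul_mul_same (Matrix.mulVec_injective_of_isUnit (isUnit_map L τ g))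

/-- Positive definiteness at `τ` is invariant under `H ↦ ᵗ(σg) H g`, `g ∈ GL₂(L)`. -/
theorem posDef_congr_iff (τ : L →+* ℂ) (g : GL (Fin 2) L) (H : Matrix (Fin 2) (Fin 2) L) :
    ((cT L (g : Matrix (Fin 2) (Fin 2) L) * H * (g : Matrix (Fin 2) (Fin 2) L)).map τ).PosDef ↔
      (H.map τ).PosDef := by
  refine ⟨fun h => ?_, posDef_congr L τ g⟩
  have h' := posDef_congr L τ g⁻¹ h
  rwa [congr_inv_congr] at h'

/-- Negative definiteness at `τ` is invariant under `H ↦ ᵗ(σg) H g`, `g ∈ GL₂(L)`. -/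
theorem negDef_congr_iff (τ : L →+* ℂ) (g : GL (Fin 2) L) (H : Matrix (Fin 2) (Fin 2) L) :
    (-(cT L (g : Matrix (Fin 2) (Fin 2) L) * H * (g : Matrix (Fin 2) (Fin 2) L)).map τ).PosDef ↔
      (-H.map τ).PosDef := by
  have e1 : -(cT L (g : Matrix (Fin 2) (Fin 2) L) * H * (g : Matrix (Fin 2) (Fin 2) L)).map τ =
      (cT L (g : Matrix (Fin 2) (Fin 2) L) * (-H) * (g : Matrix (Fin 2) (Fin 2) L)).map τ := by
    rw [← Matrix.map_neg _ (map_neg τ), Matrix.mul_neg, Matrix.neg_mul]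
  have e2 : -H.map τ = (-H).map τ := by rw [← Matrix.map_neg _ (map_neg τ)]
  rw [e1, e2]
  exact posDef_congr_iff L τ g (-H)

/-! ### Diagonal Gram matrices: the typed signature is the pair of signs -/

/-- (Ported verbatim from the HodgeCMPerL package; no docstring in the source.) -/
theorem posDef_diagonal_iff' (d : Fin 2 → L) (hd : ∀ i, conjRingHomK L (d i) = d i) (τ : L →+* ℂ) :
    ((Matrix.diagonal d).map τ).PosDef ↔ ∀ i, 0 < (τ (d i)).re := by
  rw [Matrix.diagonal_map (map_zero τ), Matrix.posDef_diagonal_iff]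
  refine forall_congr' fun i => ?_
  have him : (τ (d i)).im = 0 := by
    rw [Lemma33bLandherrProof.embedding_eq_re L (hd i) τ]; simp
  rw [Complex.lt_def]
  simp [him]

/-- (Ported verbatim from the HodgeCMPerL package; no docstring in the source.) -/
theorem negDef_diagonal_iff' (d : Fin 2 → L) (hd : ∀ i, conjRingHomK L (d i) = d i) (τ : L →+* ℂ) :
    (-(Matrix.diagonal d).map τ).PosDef ↔ ∀ i, (τ (d i)).re < 0 := by
  rw [Matrix.diagonal_map (map_zero τ), Matrix.diagonal_neg, Matrix.posDef_diagonal_iff]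
  refine forall_congr' fun i => ?_
  have him : (τ (d i)).im = 0 := by
    rw [Lemma33bLandherrProof.embedding_eq_re L (hd i) τ]; simp
  rw [Complex.lt_def]
  simp [him]

/-- Pure logic behind the plane case of Sylvester's law: for Booleans, "both true ↔ both true" and
"both false ↔ both false" force equal pair multisets. -/
theorem pair_eq_of_and_eq (p₀ p₁ q₀ q₁ : Bool) (hpos : (p₀ && p₁) = (q₀ && q₁))
    (hneg : (!p₀ && !p₁) = (!q₀ && !q₁)) : ({p₀, p₁} : Multiset Bool) = {q₀, q₁} := by
  revert hpos hneg
  cases p₀ <;> cases p₁ <;> cases q₀ <;> cases q₁ <;> simp <;> exact Multiset.pair_comm _ _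

/-- Two pairs of non-zero reals with "all positive ↔ all positive" and "all negative ↔ all negative"
have the same sign multiset (the plane case of Sylvester's law, as pure logic). -/
theorem signMultiset_eq {r s : Fin 2 → ℝ} (hr : ∀ i, r i ≠ 0) (hs : ∀ i, s i ≠ 0)
    (hpos : (∀ i, 0 < r i) ↔ (∀ i, 0 < s i)) (hneg : (∀ i, r i < 0) ↔ (∀ i, s i < 0)) :
    ({decide (0 < r 0), decide (0 < r 1)} : Multiset Bool) = {decide (0 < s 0), decide (0 < s 1)} := by
  have nr : ∀ i, ¬ 0 < r i ↔ r i < 0 := fun i =>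
    ⟨fun h => lt_of_le_of_ne (not_lt.mp h) (hr i), fun h => not_lt.mpr h.le⟩
  have ns : ∀ i, ¬ 0 < s i ↔ s i < 0 := fun i =>
    ⟨fun h => lt_of_le_of_ne (not_lt.mp h) (hs i), fun h => not_lt.mpr h.le⟩
  apply pair_eq_of_and_eq
  · rw [← Bool.decide_and, ← Bool.decide_and, decide_eq_decide]
    simpa [Fin.forall_fin_two] using hpos
  · rw [← decide_not, ← decide_not, ← decide_not, ← decide_not, ← Bool.decide_and, ← Bool.decide_and,
      decide_eq_decide, nr, nr, ns, ns]
    simpa [Fin.forall_fin_two] using hneg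

/-! ### Gram–Schmidt: every non-degenerate hermitian plane has an orthogonal basis -/

/-- Hermitian for `L/L₀`: `ᵗ(σH) = H`. -/
theorem isHermitian_congr {H : Matrix (Fin 2) (Fin 2) L} (hH : cT L H = H) (g : Matrix (Fin 2) (Fin 2) L) :
    cT L (cT L g * H * g) = cT L g * H * g := by
  rw [cT_mul, cT_mul, cT_cT, hH, Matrix.mul_assoc]

/-- Step 1: after a change of basis the `(0,0)` Gram entry is non-zero. -/
theorem exists_congr_apply00_ne_zero {H : Matrix (Fin 2) (Fin 2) L} (hH : cT L H = H) (hdet : H.det ≠ 0) :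
    ∃ g : GL (Fin 2) L,
      (cT L (g : Matrix (Fin 2) (Fin 2) L) * H * (g : Matrix (Fin 2) (Fin 2) L)) 0 0 ≠ 0 := by
  by_cases h00 : H 0 0 ≠ 0
  · exact ⟨1, by simpa using h00⟩
  rw [not_ne_iff] at h00
  by_cases h11 : H 1 1 ≠ 0
  · -- swap the basis vectors
    refine ⟨Matrix.GeneralLinearGroup.mkOfDetNeZero !![0, 1; 1, 0] (by simp [Matrix.det_fin_two]), ?_⟩
    simpa [Matrix.GeneralLinearGroup.mkOfDetNeZero, Matrix.mul_apply, Fin.sum_univ_two] using h11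
  rw [not_ne_iff] at h11
  -- `H = [[0, b], [σb, 0]]` with `b ≠ 0`; the vector `(1, b⁻¹… )` has Gram value `2`
  have h10 : H 1 0 = conjRingHomK L (H 0 1) := by
    have := congrArg (fun M => M 1 0) hH; simpa using this.symm
  have hb : H 0 1 ≠ 0 := by
    intro hb
    apply hdet
    rw [Matrix.det_fin_two, h00, h11, hb]; ring
  have hval : (cT L !![1, 0; (H 0 1)⁻¹, 1] * H * !![1, 0; (H 0 1)⁻¹, 1]) 0 0 = 2 := by
    simp [Matrix.mul_apply, Fin.sum_univ_two, h00, h11, h10, hb]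
    norm_num
  refine ⟨Matrix.GeneralLinearGroup.mkOfDetNeZero !![1, 0; (H 0 1)⁻¹, 1] (by simp [Matrix.det_fin_two]), ?_⟩
  rw [show ((Matrix.GeneralLinearGroup.mkOfDetNeZero !![1, 0; (H 0 1)⁻¹, 1]
      (by simp [Matrix.det_fin_two]) : GL (Fin 2) L) : Matrix (Fin 2) (Fin 2) L) = !![1, 0; (H 0 1)⁻¹, 1]
    from rfl, hval]
  exact two_ne_zero

/-- Step 2: if the `(0,0)` Gram entry is non-zero, one elementary column operation diagonalises. -/
theorem exists_congr_diagonal_of_apply00 {H : Matrix (Fin 2) (Fin 2) L} (hH : cT L H = H) (h00 : H 0 0 ≠ 0) :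
    ∃ g : GL (Fin 2) L, ∃ d : Fin 2 → L,
      cT L (g : Matrix (Fin 2) (Fin 2) L) * H * (g : Matrix (Fin 2) (Fin 2) L) = Matrix.diagonal d := by
  have h10 : H 1 0 = conjRingHomK L (H 0 1) := by
    have := congrArg (fun M => M 1 0) hH; simpa using this.symm
  have h00fix : conjRingHomK L (H 0 0) = H 0 0 := by
    have := congrArg (fun M => M 0 0) hH; simpa using this
  set g : Matrix (Fin 2) (Fin 2) L := !![1, -((H 0 0)⁻¹ * H 0 1); 0, 1] with hg
  have hgdet : g.det ≠ 0 := by simp [hg, Matrix.det_fin_two]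
  set X : Matrix (Fin 2) (Fin 2) L := cT L g * H * g with hX
  have hX01 : X 0 1 = 0 := by
    simp [hX, hg, Matrix.mul_apply, Fin.sum_univ_two]
    field_simp
    ring
  have hX10 : X 1 0 = 0 := by
    simp [hX, hg, Matrix.mul_apply, Fin.sum_univ_two, h10, h00fix]
    field_simp
    ring
  refine ⟨Matrix.GeneralLinearGroup.mkOfDetNeZero g hgdet, ![X 0 0, X 1 1], ?_⟩
  rw [show ((Matrix.GeneralLinearGroup.mkOfDetNeZero g hgdet : GL (Fin 2) L) : Matrix (Fin 2) (Fin 2) L) = g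
    from rfl, ← hX]
  ext i j
  fin_cases i <;> fin_cases j <;> simp [hX01, hX10]

/-- **Orthogonal bases exist** (Gram–Schmidt for `L/L₀`, rank 2): a non-degenerate hermitian plane is
isometric to a diagonal one `⟨d₀, d₁⟩` with `dᵢ ∈ L₀^×`. -/
theorem exists_diagonalize {H : Matrix (Fin 2) (Fin 2) L} (hH : cT L H = H) (hdet : H.det ≠ 0) :
    ∃ g : GL (Fin 2) L, ∃ d : Fin 2 → L, (∀ i, conjRingHomK L (d i) = d i) ∧ (∀ i, d i ≠ 0) ∧
      cT L (g : Matrix (Fin 2) (Fin 2) L) * H * (g : Matrix (Fin 2) (Fin 2) L) = Matrix.diagonal d := by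
  obtain ⟨g₁, h₁⟩ := exists_congr_apply00_ne_zero L hH hdet
  have hH₁ := isHermitian_congr L hH (g₁ : Matrix (Fin 2) (Fin 2) L)
  obtain ⟨g₂, d, h₂⟩ := exists_congr_diagonal_of_apply00 L hH₁ h₁
  have hDherm : cT L (Matrix.diagonal d) = Matrix.diagonal d := by
    rw [← h₂]; exact isHermitian_congr L hH₁ _
  have hDdet : (Matrix.diagonal d).det ≠ 0 := by
    rw [← h₂, det_congr, det_congr]
    refine mul_ne_zero (mul_ne_zero hdet (mul_ne_zero ?_ ?_)) (mul_ne_zero ?_ ?_)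
    · exact (Matrix.isUnits_det_units g₁).ne_zero
    · exact (map_ne_zero _).mpr (Matrix.isUnits_det_units g₁).ne_zero
    · exact (Matrix.isUnits_det_units g₂).ne_zero
    · exact (map_ne_zero _).mpr (Matrix.isUnits_det_units g₂).ne_zero
  refine ⟨g₁ * g₂, d, fun i => ?_, fun i => ?_, ?_⟩
  · have := congrArg (fun M => M i i) hDherm
    simpa using this
  · rw [Matrix.det_diagonal, Fin.prod_univ_two] at hDdet
    fin_cases i
    · exact left_ne_zero_of_mul hDdet
    · exact right_ne_zero_of_mul hDdet
  · rw [Matrix.GeneralLinearGroup.coe_mul, cT_mul, ← h₂]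
    simp only [Matrix.mul_assoc]

/-! ### Landherr's theorem for hermitian planes with arbitrary Gram matrices -/

/-- The sign multisets of two diagonalised planes agree when the typed signatures of the original Gram
matrices agree at `τ`. -/
theorem signs_of_sig {H H' : Matrix (Fin 2) (Fin 2) L} (τ : L →+* ℂ)
    (hsig : ((H.map τ).PosDef ↔ (H'.map τ).PosDef) ∧ ((-H.map τ).PosDef ↔ (-H'.map τ).PosDef))
    {g g' : GL (Fin 2) L} {d d' : Fin 2 → L} (hd : ∀ i, conjRingHomK L (d i) = d i)
    (hd' : ∀ i, conjRingHomK L (d' i) = d' i) (hd0 : ∀ i, d i ≠ 0) (hd0' : ∀ i, d' i ≠ 0)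
    (hD : cT L (g : Matrix (Fin 2) (Fin 2) L) * H * (g : Matrix (Fin 2) (Fin 2) L) = Matrix.diagonal d)
    (hD' : cT L (g' : Matrix (Fin 2) (Fin 2) L) * H' * (g' : Matrix (Fin 2) (Fin 2) L) = Matrix.diagonal d') :
    ({decide (0 < (τ (d 0)).re), decide (0 < (τ (d 1)).re)} : Multiset Bool) =
      {decide (0 < (τ (d' 0)).re), decide (0 < (τ (d' 1)).re)} := by
  have hre : ∀ {x : L}, conjRingHomK L x = x → x ≠ 0 → (τ x).re ≠ 0 := by
    intro x hx hx0 h0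
    apply hx0
    have := Lemma33bLandherrProof.embedding_eq_re L hx τ
    rw [h0] at this
    exact (map_eq_zero τ).mp (by simpa using this)
  refine signMultiset_eq (r := fun i => (τ (d i)).re) (s := fun i => (τ (d' i)).re)
    (fun i => hre (hd i) (hd0 i)) (fun i => hre (hd' i) (hd0' i)) ?_ ?_
  · rw [← posDef_diagonal_iff' L d hd τ, ← posDef_diagonal_iff' L d' hd' τ, ← hD, ← hD',
      posDef_congr_iff, posDef_congr_iff]
    exact hsig.1
  · rw [← negDef_diagonal_iff' L d hd τ, ← negDef_diagonal_iff' L d' hd' τ, ← hD, ← hD',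
      negDef_congr_iff, negDef_congr_iff]
    exact hsig.2

/-- **Landherr's theorem for hermitian planes, classification direction, arbitrary Gram matrices.**
Two non-degenerate `σ`-hermitian `2 × 2` matrices over the CM field `L` with the same signature at every
complex embedding and the same discriminant class in `L₀^× / N(L^×)` are congruent: `ᵗ(σg) H g = H'` for
some `g ∈ GL₂(L)`.  From `HodgeCM.lemma33bLandherr_holds` (the diagonal case, PerL Lemma 3.3(b)) by
Gram–Schmidt. -/
theorem landherr_planes (H H' : Matrix (Fin 2) (Fin 2) L)
    (hH : H.transpose.map (conjRingHomK L) = H) (hH' : H'.transpose.map (conjRingHomK L) = H')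
    (hdet : H.det ≠ 0) (hdet' : H'.det ≠ 0)
    (hsig : ∀ τ : L →+* ℂ,
      ((H.map τ).PosDef ↔ (H'.map τ).PosDef) ∧ ((-H.map τ).PosDef ↔ (-H'.map τ).PosDef))
    (hdisc : ∃ z : L, z ≠ 0 ∧ H.det = H'.det * (z * conjRingHomK L z)) :
    ∃ g : GL (Fin 2) L,
      ((g : Matrix (Fin 2) (Fin 2) L).transpose.map (conjRingHomK L)) * H *
        (g : Matrix (Fin 2) (Fin 2) L) = H' := by
  obtain ⟨g, d, hd, hd0, hD⟩ := exists_diagonalize L hH hdet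
  obtain ⟨g', d', hd', hd0', hD'⟩ := exists_diagonalize L hH' hdet'
  -- Landherr's invariants for the diagonalised planes `⟨d₀, d₁⟩`, `⟨d'₀, d'₁⟩`
  set a : Fin 4 → L := ![d 0, d 1, d' 0, d' 1] with ha_def
  have ha : ∀ i, conjRingHomK L (a i) = a i := by
    intro i; fin_cases i
    · exact hd 0
    · exact hd 1
    · exact hd' 0
    · exact hd' 1
  have ha0 : ∀ i, a i ≠ 0 := by
    intro i; fin_cases i
    · exact hd0 0
    · exact hd0 1
    · exact hd0' 0
    · exact hd0' 1
  have hdiag : Matrix.diagonal ![a 0, a 1] = Matrix.diagonal d := by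
    congr 1; ext i; fin_cases i <;> rfl
  have hdiag' : Matrix.diagonal ![a 2, a 3] = Matrix.diagonal d' := by
    congr 1; ext i; fin_cases i <;> rfl
  have hsig_d : ∀ τ : L →+* ℂ,
      ({decide (0 < (τ (a 0)).re), decide (0 < (τ (a 1)).re)} : Multiset Bool) =
        {decide (0 < (τ (a 2)).re), decide (0 < (τ (a 3)).re)} :=
    fun τ => signs_of_sig L τ (hsig τ) hd hd' hd0 hd0' hD hD'
  have hdisc_d : ∃ z : L, z ≠ 0 ∧ a 0 * a 1 = a 2 * a 3 * (z * conjRingHomK L z) := by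
    obtain ⟨z, hz, hzH⟩ := hdisc
    have e := det_congr L (g : Matrix (Fin 2) (Fin 2) L) H
    rw [hD, Matrix.det_diagonal, Fin.prod_univ_two] at e
    have e' := det_congr L (g' : Matrix (Fin 2) (Fin 2) L) H'
    rw [hD', Matrix.det_diagonal, Fin.prod_univ_two] at e'
    have hg0 : (g : Matrix (Fin 2) (Fin 2) L).det ≠ 0 := (Matrix.isUnits_det_units g).ne_zero
    have hg0' : (g' : Matrix (Fin 2) (Fin 2) L).det ≠ 0 := (Matrix.isUnits_det_units g').ne_zero
    have hg0c : conjRingHomK L (g' : Matrix (Fin 2) (Fin 2) L).det ≠ 0 := (map_ne_zero _).mpr hg0'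
    refine ⟨z * (g : Matrix (Fin 2) (Fin 2) L).det * ((g' : Matrix (Fin 2) (Fin 2) L).det)⁻¹,
      mul_ne_zero (mul_ne_zero hz hg0) (inv_ne_zero hg0'), ?_⟩
    change d 0 * d 1 = d' 0 * d' 1 * _
    rw [e, e', hzH]
    simp only [map_mul, map_inv₀]
    field_simp
  obtain ⟨k, hk⟩ := lemma33bLandherr_holds L a ha ha0 hsig_d hdisc_d
  rw [hdiag, hdiag'] at hk
  refine ⟨g * k * g'⁻¹, ?_⟩
  change cT L _ * H * _ = H'
  calc cT L ((g * k * g'⁻¹ : GL (Fin 2) L) : Matrix (Fin 2) (Fin 2) L) * H *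
        ((g * k * g'⁻¹ : GL (Fin 2) L) : Matrix (Fin 2) (Fin 2) L)
      = cT L ((g'⁻¹ : GL (Fin 2) L) : Matrix (Fin 2) (Fin 2) L) *
          (cT L (k : Matrix (Fin 2) (Fin 2) L) *
            (cT L (g : Matrix (Fin 2) (Fin 2) L) * H * (g : Matrix (Fin 2) (Fin 2) L)) *
            (k : Matrix (Fin 2) (Fin 2) L)) *
          ((g'⁻¹ : GL (Fin 2) L) : Matrix (Fin 2) (Fin 2) L) := by
        simp only [Matrix.GeneralLinearGroup.coe_mul, cT_mul, Matrix.mul_assoc]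
    _ = cT L ((g'⁻¹ : GL (Fin 2) L) : Matrix (Fin 2) (Fin 2) L) *
          (cT L (g' : Matrix (Fin 2) (Fin 2) L) * H' * (g' : Matrix (Fin 2) (Fin 2) L)) *
          ((g'⁻¹ : GL (Fin 2) L) : Matrix (Fin 2) (Fin 2) L) := by
        rw [hD, show cT L (k : Matrix (Fin 2) (Fin 2) L) = (k : Matrix (Fin 2) (Fin 2) L).transpose.map
          (conjRingHomK L) from rfl, hk, hD']
    _ = H' := congr_inv_congr L g' H'


-- port_pkg: scope closed for this part
end LandherrHermitian
end HodgeCM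
end
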